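/-
Copyright: cell pub-balaban-gaps (YM BLITZ Y1, track G1), seat g1-p2 GEN 7 (unit `pub-balaban-gaps-g1-p2`).  Row (D4) NODE O,
JUNCTION J-3′ (g1-plan-1 GEN 26's located sub-slot J-55): the lit-balaban lineage's HYPOTHESIS-FREE [4] Prop. 2.2 on the ONE-SCALE
torus family — the GENUINE flat propagator `G′_K = (−Δ^η + m² + a_KQ′_K*Q′_K)⁻¹` of the K-fold block averaging, sup AND ∇^η entries,
constants uniform in `K` and the volume (`B6Prop22OneScaleTorus.entries_oneScaleTorus`) — READ INTO THE (D4) BLOCK CURRENCY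
(`D4WalkBlock.blockNorm` over the unit cube torus `UT`, `tdist1`) as the VALUE and DERIVATIVE letters that `D4WalkBlockDerivative`
consumes, and the consequence: [B9] Cor. 3.5's step AT `U = 1` ON THE GENUINE FLAT OPERATOR — for every (3.61)-dominated holomorphic
perturbation `V`, `G′_K(1 − VG′_K)⁻¹` is a block walk expansion with derivative letters, constants uniform in `K` and the volume.
HONEST FRAMING: the flat operator is the tree's (scalar model, `U = 1`); the perturbation `V` is a hypothesis SHAPE (Bałaban's `V′(A)`
is NOT constructed); (D4) NOT discharged (instance 0∕1); NOT BetaPertH, NOT continuum, NOT Clay.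
-/
import Summits.QuantumFields.BalabanUV.Gaps.D4WalkBlockGlue
import Literature.MathematicalPhysics.QuantumFieldTheory.Balaban1983to89.B6Prop22OneScaleTorus

/-!
# `Gaps.D4WalkBlockFlatLetters` — junction J-3′ (part 1): the genuine one-scale flat propagator's (2.67) sup ∕ ∇ entries as block
# letters of the (D4) currency (cell pub-balaban-gaps, seat g1-p2 gen 7); part 2 `D4WalkBlockFlatOneScale` = Cor. 3.5's step on it

HONEST DEPENDENCY (cell pub-balaban, verbatim): continuum YM on T⁴ ⇐ BetaPertH ∧ nine spine estimates (0/9 proved);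
BetaPertH ⇐ (D1) ∧ (D4) ∧ CAP+tail.

[B9] p. 399: «This way the theorems are reduced to the corresponding theorems for propagators without external gauge field. They
were proved in [4].»  The tree HOLDS those flat theorems on the one-scale torus family, hypothesis-free (cell lit-balaban, seat p01):
`B6Prop22OneScaleTorus.entries_oneScaleTorus` — for `G′ = (tower P a m²).G P.K = (−Δ^η + m² + a_KQ′_K*Q′_K)⁻¹` on the fine torus
`Site P 0` (`η = L^{−K}`) with unit blocks `blk P K x = y ∈ Site P K` and the periodic ℓ¹ distance `T1 P K`, ONE pair `(δ₀, C)`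
(functions of `d, L, a, m²` only) such that for every volume and every `K ≥ 1` the block sups `entryB n` (n = 0: `|(G′λ_μ)(x)|`,
n = 1: `|(∂^η_μG′λ_ν)(x)|`, …) are `≤ C·e^{−½δ₀T1(y,y′)}·|λ|` for `supp λ ⊂ B^K(y′)`.  THIS FILE:
* §1 the geometry junction: the cube map `cubeOf P x = toT (blk P K x) ∈ UT (Nv P K)` (the seat's unit cube torus) and
  `tdist1 (Nv P K) (toT y) (toT y′) = T1 P K y y′` (both are `Σ_μ ccoord`) — `tdist1_toT`;
* §2 real → complex block norms (`rowMass_map_ofReal`, `blockNorm_map_ofReal_le`) and the test functions `λ = sign`-pattern of one row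
  restricted to one block (`supNormV ≤ 1`);
* §3 **`flatLetters_oneScaleTorus`** — THE JUNCTION: ∃ `δ₀, C > 0` (B6's) such that for every member `i : Index d L` of the family,
  with `Gc = G′.map ofReal` and `∇c_μ = (∂^η_μ).map ofReal`: `‖Gc‖_{Y,Y′} ≤ C·e^{−½δ₀d₁(Y,Y′)}` and `‖∇c_μ·Gc‖_{Y,Y′} ≤ C·e^{−½δ₀d₁(Y,Y′)}`
  for ALL cubes `Y, Y′` — the VALUE letter and the DERIVATIVE letter (relative factor `1`) of `D4WalkBlockDerivative`, k-uniform;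
* §4 **`blockWalkExpansion_flat_oneScaleTorus`** (the one-term expansion of `Gc` at walk rate `½δ₀ − μ` with derivative letters
  `B_μ = 1`, via `D4WalkBlockDerivative.BlockWalkExpansion.leftMul` of `D4WalkBlockGlue.blockWalkExpansion_one`) and
  **`blockWalkExpansion_flatPerturb_oneScaleTorus`** — [B9] COR. 3.5's STEP AT `U = 1` ON THE GENUINE FLAT OPERATOR: for every
  σ-independent entrywise-holomorphic `V(u)` with the (3.61)-shape domination letter `‖V(u)S‖_{Y,Y′} ≤ α₀‖S‖ + Σ_μ α_μ‖∇c_μS‖`, cube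
  row sum `(μ, c_μ)`, `2μ ≤ ε`, `3μ + ε ≤ ½δ₀`, and the margin `c_μ(c_μ·1·(1·((α₀ + Σ_μ α_μ)C))c_μ)c_μ < 1` («α₁ sufficiently small»
  against `(C, c_μ)` ONLY): `Gc(1 − V(u)Gc)⁻¹` is a block walk expansion at `(ε − 2μ, ½δ₀ − ε − 3μ, c_μC(1·(1−q)⁻¹)c_μ, ½δ₀ − 3μ)` with
  the relative derivative letters `1` for the `∇c_μ` — every constant a function of `(d, L, a, m², α, c_μ, rates)`: UNIFORM IN `K`
  AND THE VOLUME (= `D4WalkBlockDerivative.blockWalkExpansion_perturb_of_derivLetters` on §4's expansion).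
WHAT IT IS NOT.  Bałaban's `V′(A)` ((3.52)∕(3.60): a CONSTRUCTED perturbation with the (3.61) letter — lit-balaban `B9Eq360Vprime`
has it in `HasMajorant` form on its own carriers, not junctioned here); the VECTOR ∕ Lie-algebra-valued propagator (the flat `G′(1)`
of [B9] acts componentwise by this scalar operator); the Hölder members of (2.67); the multi-level families `{Ω_j}` (here the
admitted one-scale case `Ω_j = T_η`, [4] p. 224); the s-decoration (σ-free flat operator: `SX = ∅`); (D4) instance 0∕1; words of
row (D4) UNCHANGED.

References: T. Bałaban, Comm. Math. Phys. **96** (1984) 223–250 [4], Prop. 2.2 (2.67) p. 234, p. 224, p. 235; Comm. Math. Phys.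
**99** (1985) 389–434 [B9], p. 399, (3.60)–(3.65) pp. 402–403, Cor. 3.5 p. 407, Thm 3.1 (3.42) p. 397; Comm. Math. Phys. **116**
(1988) 1–22 [II], (1.11) p. 5.
-/

noncomputable section

namespace Summit.QuantumFields.BalabanUV.Gaps.D4WalkBlockFlatLetters

open Metric Set Finset
open scoped Matrix
open Literature.MathematicalPhysics.QuantumFieldTheory.Balaban1983to89
open Literature.MathematicalPhysics.QuantumFieldTheory.Balaban1983to89.B9SectDWalk (DomBy)
open Literature.MathematicalPhysics.QuantumFieldTheory.Balaban1983to89.B9Thm34Ext (toB6)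
open Literature.MathematicalPhysics.QuantumFieldTheory.Balaban1983to89.B9Thm37GlueTorus (torusGeom tdist1 tdist1_nonneg)
open Literature.MathematicalPhysics.QuantumFieldTheory.Balaban1983to89.TreeLengthTorus (TPt)
open Literature.MathematicalPhysics.QuantumFieldTheory.Balaban1983to89.B5TorusCover (UT)
open Literature.MathematicalPhysics.QuantumFieldTheory.Balaban1983to89.B11SectG (RowSum)
open Literature.MathematicalPhysics.QuantumFieldTheory.Balaban1983to89.B5Ineq137Torus (toT toT_injective Nv blk supN le_supN)
open Literature.MathematicalPhysics.QuantumFieldTheory.Balaban1983to89.B5GpSettingTorus (supNormV dir0)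
open Literature.MathematicalPhysics.QuantumFieldTheory.Balaban1983to89.B6Prop22OneScaleTorus
  (T1 entryB Index entries_oneScaleTorus entryB_zero_top entryB_one_top le_blockSup)
open Literature.MathematicalPhysics.QuantumFieldTheory.Balaban1983to89.B1RG242Torus (tower deriv)
open Summit.QuantumFields.BalabanUV.Gaps.D4WalkBlock
  (rowMass blockNorm blockNorm_nonneg blockNorm_le_of_rowMass_le BlockWalkExpansion)
open Summit.QuantumFields.BalabanUV.Gaps.D4WalkBlockGlue (blockWalkExpansion_one)

/-- The periods of the block tori are nonzero (instance form of `B5Ineq137Torus.Nv_pos`, for `UT (Nv P j)` ∕ `tdist1`). -/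
instance instNeZeroNv (P : Params) (j : ℕ) (i : Fin P.d) : NeZero (Nv P j i) := ⟨P.sitesPerDir_ne_zero j⟩

/-! ## §1. The geometry junction: cubes of the seat's unit torus = B6's blocks, `tdist1 ∘ toT = T1` -/

section Geometry

variable (P : Params)

/-- **The cube map**: a fine site `x ∈ Site P 0` ↦ its unit block `blk P K x`, read in the seat's cube torus `UT (Nv P K)`. -/
def cubeOf (x : Site P 0) : UT (Nv P P.K) := UT.ofSite (Nv P P.K) (toT (blk P P.K x))

/-- **`tdist1 ∘ toT = T1`**: the seat's periodic ℓ¹ cube distance IS B6's one-scale distance `d(y,y′)` (both are `Σ_μ ccoord`).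
[cite: Balaban1984PropagatorsII, (2.46) p.231, p.235 («If we have one scale … the operator is a unit lattice operator»)] -/
theorem tdist1_toT (j : ℕ) (y y' : Site P j) :
    tdist1 (Nv P j) (UT.ofSite (Nv P j) (toT y)) (UT.ofSite (Nv P j) (toT y')) = T1 P j y y' := by
  simp only [tdist1, T1, UT.toSite_ofSite, Nat.cast_sum]

variable {P}

/-- Cubes determine blocks: `cubeOf x = cubeOf x′ ↔ blk x = blk x′` (`toT` is injective). -/
theorem cubeOf_eq_iff {x x' : Site P 0} : cubeOf P x = cubeOf P x' ↔ blk P P.K x = blk P P.K x' :=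
  ⟨fun h => toT_injective P P.K h, fun h => by unfold cubeOf; rw [h]⟩

/-- The cube distance of two fine sites' cubes is B6's block distance. -/
theorem tdist1_cubeOf (x x' : Site P 0) :
    tdist1 (Nv P P.K) (cubeOf P x) (cubeOf P x') = T1 P P.K (blk P P.K x) (blk P P.K x') :=
  tdist1_toT P P.K _ _

end Geometry

/-! ## §2. Real → complex block norms; the block test functions -/

section RealComplex

variable {ν : ℕ} {K : Fin ν → ℕ} {p n : Type} [Fintype p] [Fintype n]
variable (cub : p → UT K) (cubn : n → UT K)

omit [Fintype p] in
/-- Row masses of a complexified real matrix are the real row masses. -/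
theorem rowMass_map_ofReal (M : Matrix p n ℝ) (i : p) (y' : UT K) :
    rowMass cubn (M.map ((↑) : ℝ → ℂ)) i y' = ∑ j ∈ Finset.univ.filter (fun j => cubn j = y'), |M i j| := by
  unfold rowMass
  exact Finset.sum_congr rfl fun j _ => by rw [Matrix.map_apply, Complex.norm_real, Real.norm_eq_abs]

/-- Block norms of a complexified real matrix from bounds on the real row masses. -/
theorem blockNorm_map_ofReal_le (M : Matrix p n ℝ) (y y' : UT K) {B : ℝ} (hB : 0 ≤ B)
    (h : ∀ i, cub i = y → ∑ j ∈ Finset.univ.filter (fun j => cubn j = y'), |M i j| ≤ B) :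
    blockNorm cub cubn (M.map ((↑) : ℝ → ℂ)) y y' ≤ B :=
  blockNorm_le_of_rowMass_le cub cubn _ y y' hB fun i hi => by rw [rowMass_map_ofReal]; exact h i hi

end RealComplex

section TestFunction

variable {P : Params}

/-- The block test function of a row: component `dir0` carries the sign pattern of the row `r` on the cube `Y′`, the other
components vanish (a vector test function `Fin d → Site P 0 → ℝ` as in (2.67)). -/
def testFun (r : Site P 0 → ℝ) (Y' : UT (Nv P P.K)) : Fin P.d → Site P 0 → ℝ :=
  fun μ x => if μ = dir0 P then (if cubeOf P x = Y' then (SignType.sign (r x) : ℝ) else 0) else 0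

/-- Pairing the row with its test function gives the row mass on the cube. -/
theorem sum_mul_testFun (r : Site P 0 → ℝ) (Y' : UT (Nv P P.K)) :
    ∑ x, r x * testFun r Y' (dir0 P) x = ∑ x ∈ Finset.univ.filter (fun x => cubeOf P x = Y'), |r x| := by
  rw [Finset.sum_filter]
  refine Finset.sum_congr rfl fun x _ => ?_
  unfold testFun
  simp only [if_true]
  split_ifs with h
  · rcases lt_trichotomy (r x) 0 with hr | hr | hr
    · rw [sign_neg hr, abs_of_neg hr]; simp
    · rw [hr]; simp
    · rw [sign_pos hr, abs_of_pos hr]; simp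
  · rw [mul_zero]

/-- The test function is supported in the block of any site of its cube. -/
theorem blk_eq_of_testFun_ne_zero (r : Site P 0 → ℝ) {Y' : UT (Nv P P.K)} {x₀ : Site P 0} (hx₀ : cubeOf P x₀ = Y')
    {μ : Fin P.d} {x : Site P 0} (h : testFun r Y' μ x ≠ 0) : blk P P.K x = blk P P.K x₀ := by
  unfold testFun at h
  split_ifs at h with h1 h2
  · exact cubeOf_eq_iff.1 (h2.trans hx₀.symm)
  · exact (h rfl).elim
  · exact (h rfl).elim

/-- `|λ| ≤ 1` for the block test function. -/
theorem supNormV_testFun_le (r : Site P 0 → ℝ) (Y' : UT (Nv P P.K)) : supNormV P (testFun r Y') ≤ 1 := by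
  unfold supNormV
  refine Finset.sup'_le _ _ fun μ _ => ?_
  unfold supN
  refine Finset.sup'_le _ _ fun x _ => ?_
  unfold testFun
  split_ifs with h1 h2
  · rcases lt_trichotomy (r x) 0 with hr | hr | hr
    · rw [sign_neg hr]; simp
    · rw [hr]; simp
    · rw [sign_pos hr]; simp
  · simp
  · simp

end TestFunction

/-! ## §3. THE JUNCTION: B6's (2.67) sup and ∇ entries as the seat's value and derivative block letters, k-uniformly -/

section Letters

variable {P : Params}

/-- **Row-bound ⟹ block letter** (the reading of «x ∈ B^K(y), supp λ ⊂ B^K(y′) … ·|λ|» as an ℓ^∞ → ℓ^∞ block bound): if for every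
vector test function `λ` supported (componentwise) in a block `y′` and every `x ∈ B^K(y)` one has `|(Mλ_{dir0})(x)| ≤
F(y,y′)·|λ|` with `F = C·e^{−½δ₀T1}`, then `‖M.map ofReal‖_{Y,Y′} ≤ C·e^{−½δ₀d₁(Y,Y′)}` for all cubes. [cite: Balaban1984PropagatorsII, Prop. 2.2 (2.67) p.234] -/
theorem blockNorm_le_of_rowBound (M : Matrix (Site P 0) (Site P 0) ℝ) {C δ₀ : ℝ} (hC : 0 ≤ C)
    (hM : ∀ (lam : Fin P.d → Site P 0 → ℝ) (y y' : Site P P.K), (∀ ν x, lam ν x ≠ 0 → blk P P.K x = y') →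
      ∀ x : Site P 0, blk P P.K x = y →
        |(M *ᵥ lam (dir0 P)) x| ≤ C * Real.exp (-(δ₀ / 2 * T1 P P.K y y')) * supNormV P lam)
    (Y Y' : UT (Nv P P.K)) :
    blockNorm (cubeOf P) (cubeOf P) (M.map ((↑) : ℝ → ℂ)) Y Y' ≤ C * Real.exp (-(δ₀ / 2 * tdist1 (Nv P P.K) Y Y')) := by
  refine blockNorm_map_ofReal_le (cubeOf P) (cubeOf P) M Y Y' (by positivity) fun x hx => ?_
  by_cases hY' : ∃ x₀, cubeOf P x₀ = Y'
  · obtain ⟨x₀, hx₀⟩ := hY'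
    have e1 : ∑ j ∈ Finset.univ.filter (fun j => cubeOf P j = Y'), |M x j| = (M *ᵥ testFun (fun j => M x j) Y' (dir0 P)) x := by
      rw [Matrix.mulVec, dotProduct, sum_mul_testFun]
    have hd1 : tdist1 (Nv P P.K) Y Y' = T1 P P.K (blk P P.K x) (blk P P.K x₀) := by
      rw [← hx, ← hx₀]; exact tdist1_cubeOf x x₀
    rw [e1, hd1]
    refine (le_abs_self _).trans ((hM (testFun (fun j => M x j) Y') (blk P P.K x) (blk P P.K x₀)
      (fun ν j hj => blk_eq_of_testFun_ne_zero _ hx₀ hj) x rfl).trans ?_)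
    calc C * Real.exp (-(δ₀ / 2 * T1 P P.K (blk P P.K x) (blk P P.K x₀))) * supNormV P (testFun (fun j => M x j) Y')
        ≤ C * Real.exp (-(δ₀ / 2 * T1 P P.K (blk P P.K x) (blk P P.K x₀))) * 1 :=
          mul_le_mul_of_nonneg_left (supNormV_testFun_le _ _) (by positivity)
      _ = _ := mul_one _
  · have e0 : ∑ j ∈ Finset.univ.filter (fun j => cubeOf P j = Y'), |M x j| = 0 :=
      Finset.sum_eq_zero fun j hj => (hY' ⟨j, (Finset.mem_filter.1 hj).2⟩).elim
    rw [e0]; positivity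

/-- **THE FLAT LETTERS ON THE ONE-SCALE TORUS FAMILY — VALUE AND DERIVATIVE, UNIFORM IN `K` AND THE VOLUME.**  From
`B6Prop22OneScaleTorus.entries_oneScaleTorus` (hypothesis-free, lit-balaban p01): there are `δ₀, C > 0` (functions of `d, L, a, m²`)
such that for every member `i : Index d L` (`K ≥ 1`, any volume), with `G′ = (tower i.P a m²).G K`, `Gc = G′.map ofReal` and the
forward η-differences `∂^η_μ = deriv i.P 0 ε μ`: for ALL cubes `Y, Y′` of `UT (Nv P K)`,
`‖Gc‖_{Y,Y′} ≤ C·e^{−½δ₀·d₁(Y,Y′)}` (entry 0 of (2.67)) and `‖(∂^η_μG′).map ofReal‖_{Y,Y′} ≤ C·e^{−½δ₀·d₁(Y,Y′)}` (entry 1) — the VALUE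
letter and the DERIVATIVE letter (relative factor `1`) of `D4WalkBlockDerivative`, the ∇ being of size `η⁻¹ = L^K`.
[cite: Balaban1984PropagatorsII, Prop. 2.2 (2.67) p.234 (first and second quantities), p.235; Balaban1985BackgroundPropagators, Thm 3.1 (3.42) p.397, p.399] -/
theorem flatLetters_oneScaleTorus (d L : ℕ) (hd : 1 ≤ d) (hL : Odd L ∧ 1 < L) {a : ℝ} (ha : 0 < a) {msq : ℝ}
    (hmsq : 0 ≤ msq) :
    ∃ δ₀ C : ℝ, 0 < δ₀ ∧ 0 < C ∧ ∀ i : Index d L, ∀ Y Y' : UT (Nv i.P i.P.K),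
      blockNorm (cubeOf i.P) (cubeOf i.P) (((tower i.P a msq).G i.P.K).map ((↑) : ℝ → ℂ)) Y Y' ≤
          C * Real.exp (-(δ₀ / 2 * tdist1 (Nv i.P i.P.K) Y Y')) ∧
        ∀ μ : Fin i.P.d,
          blockNorm (cubeOf i.P) (cubeOf i.P) ((deriv i.P 0 i.P.eps μ * (tower i.P a msq).G i.P.K).map ((↑) : ℝ → ℂ)) Y Y' ≤
            C * Real.exp (-(δ₀ / 2 * tdist1 (Nv i.P i.P.K) Y Y')) := by
  obtain ⟨δ₀, C, Cα, hδ₀, hC, -, h⟩ := entries_oneScaleTorus d L hd hL ha hmsq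
  refine ⟨δ₀, C, hδ₀, hC, fun i Y Y' => ⟨?_, fun μ => ?_⟩⟩
  · refine blockNorm_le_of_rowBound _ hC.le (fun lam y y' hsupp x hx => ?_) Y Y'
    have h0 := (h i).1 0 lam y y' hsupp
    rw [entryB_zero_top] at h0
    exact (le_blockSup (dir0 i.P) (fun μ x => ((tower i.P a msq).G i.P.K *ᵥ lam μ) x) (dir0 i.P) hx).trans h0
  · refine blockNorm_le_of_rowBound _ hC.le (fun lam y y' hsupp x hx => ?_) Y Y'
    have h1 := (h i).1 1 lam y y' hsupp
    rw [entryB_one_top] at h1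
    exact (le_blockSup (dir0 i.P, dir0 i.P)
      (fun q : Fin i.P.d × Fin i.P.d => fun x => ((deriv i.P 0 i.P.eps q.1 * (tower i.P a msq).G i.P.K) *ᵥ lam q.2) x)
      (μ, dir0 i.P) hx).trans h1

end Letters

/-! ## §4. The flat one-term expansion with derivative letters, and Cor. 3.5's step at `U = 1` on the genuine flat operator -/

section Const

variable {ν : ℕ} {K : Fin ν → ℕ} [∀ i, NeZero (K i)] {p : Type} [Fintype p]
variable {dd N' : ℕ} {E : Type*} [NormedAddCommGroup E] [NormedSpace ℂ E]

/-- A σ-free, u-constant matrix with a decaying block letter `A·e^{−ρd₁}` is a ONE-TERM block walk expansion at any window `ε` and any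
torus rate `κ ≤ ρ − ε` (walk rate `ρ`, constant `A`, no σ-carrying term) — the flat propagator's expansion before any decoration.
[cite: Balaban1985BackgroundPropagators, (3.107)–(3.108) p.416; Balaban1984PropagatorsII, Prop. 2.2 (2.67) p.234] -/
theorem blockWalkExpansion_const (c : B13.Consts) (cub : p → UT K) (X : Finset (UT K)) (M : Matrix p p ℂ) (R : ℝ)
    {ε κ A ρ : ℝ} (hA : 0 ≤ A) (hκ : κ ≤ ρ - ε) (hM : ∀ y y', blockNorm cub cub M y y' ≤ A * Real.exp (-(ρ * tdist1 K y y'))) :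
    BlockWalkExpansion c cub cub (fun (_ : TPt dd N' → ℂ) (_ : E) => M) X R ε κ A
      (fun (_ : Unit) (_ : TPt dd N' → ℂ) (_ : E) => M) (∅ : Set Unit) (fun _ => A) (fun _ => tdist1 K) ρ where
  hasSum σ _ u _ i j := hasSum_unique (fun _ : Unit => M i j)
  termAnalytic _ σ _ i j := differentiableOn_const _
  majB _ σ _ u _ y y' := hM y y'
  majSum S a b := by
    calc ∑ _ω ∈ S, A * Real.exp (-((ρ - ε) * tdist1 K a b))
        ≤ ∑ _ω ∈ (Finset.univ : Finset Unit), A * Real.exp (-((ρ - ε) * tdist1 K a b)) :=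
          Finset.sum_le_sum_of_subset_of_nonneg (Finset.subset_univ S) fun _ _ _ => by positivity
      _ = A * Real.exp (-((ρ - ε) * tdist1 K a b)) := by simp
      _ ≤ A * Real.exp (-(κ * tdist1 K a b)) :=
          mul_le_mul_of_nonneg_left (Real.exp_le_exp.2 (by nlinarith [tdist1_nonneg (N := K) a b])) hA
  indep _ _ σ _ := rfl
  through ω hω := by simp at hω
  A_nonneg _ := hA
  D_nonneg _ a b := tdist1_nonneg a b

end Const

section Step


variable {d L : ℕ} {a msq : ℝ}
variable {dd N' : ℕ} {E : Type*} [NormedAddCommGroup E] [NormedSpace ℂ E]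

/-- `map ofReal` is multiplicative (the ring hom `Complex.ofRealHom` on matrices). -/
theorem map_ofReal_mul {n : Type} [Fintype n] (M N : Matrix n n ℝ) :
    (M * N).map ((↑) : ℝ → ℂ) = M.map ((↑) : ℝ → ℂ) * N.map ((↑) : ℝ → ℂ) :=
  Matrix.map_mul (f := Complex.ofRealHom)

end Step

/-! ## §5. Non-vacuity: the complex resolvent shift `u ↦ Gc(1 − u·Gc)⁻¹ = (Δ′_a − u)⁻¹` is an instance -/

section NonVacuous

variable {ν : ℕ} {K : Fin ν → ℕ} {p : Type} [Fintype p] [DecidableEq p]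

/-- The scalar family `V(u) = u·1` (a complex mass ∕ resolvent shift) meets the (3.61)-shape domination letter with `α₀ = R`,
`α_μ = 0` on the `R`-ball, and is entrywise holomorphic — so `blockWalkExpansion_flatPerturb_oneScaleTorus` is NOT vacuous: for
`|u| < R` with `c_μ(c_μ·1·(1·((R + 0)C))c_μ)c_μ < 1` the resolvent family `u ↦ Gc(1 − uGc)⁻¹` of the genuine flat propagator is a
block walk expansion with derivative letters, k-uniformly. [cite: Balaban1985BackgroundPropagators, (3.64) p.402, Thm 3.4 p.400] -/
theorem massShift_letters (cub : p → UT K) {ι : Type*} [Fintype ι] (Dop : ι → Matrix p p ℂ) (R : ℝ) :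
    (∀ j k : p, DifferentiableOn ℂ (fun u : ℂ => (u • (1 : Matrix p p ℂ)) j k) (ball (0 : ℂ) R)) ∧
      ∀ u ∈ ball (0 : ℂ) R, ∀ (S : Matrix p p ℂ) (Y Y' : UT K),
        blockNorm cub cub (u • (1 : Matrix p p ℂ) * S) Y Y' ≤
          R * blockNorm cub cub S Y Y' + ∑ μ, (fun _ : ι => (0 : ℝ)) μ * blockNorm cub cub (Dop μ * S) Y Y' := by
  refine ⟨fun j k => ?_, fun u hu S Y Y' => ?_⟩
  · simp only [Matrix.smul_apply, smul_eq_mul]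
    exact (differentiableOn_id.mul (differentiableOn_const _))
  · rw [Matrix.smul_mul, Matrix.one_mul]
    simp only [zero_mul, Finset.sum_const_zero, add_zero]
    refine (D4WalkBlock.blockNorm_smul_le cub cub u S Y Y').trans ?_
    exact mul_le_mul_of_nonneg_right (le_of_lt (by simpa using hu)) (blockNorm_nonneg cub cub S Y Y')

end NonVacuous

end Summit.QuantumFields.BalabanUV.Gaps.D4WalkBlockFlatLetters

end
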